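import Literature.MathematicalPhysics.QuantumFieldTheory.Balaban1983to89.Beta.BlockLegs
import Literature.MathematicalPhysics.QuantumFieldTheory.Balaban1983to89.Beta.TransferUV

/-!
# `Beta.GradedBubbles` — graded located-pair stencils on `ℤ⁴` and the decay of their one-loop bubbles:
# three vertex differences through legs with sharp differences give degree 7, hence NO logarithm

HONEST FRAMING (cell `pub-balaban`, β sub-cell, analysis prover AN3, generation 15).  Discharging `BetaPertH` would make
Bałaban's ultraviolet stability UNCONDITIONAL — a real constructive-QFT result; it is NOT the continuum limit and NOT the Clay
problem.  This file discharges nothing of the kind: it is ELEMENTARY REAL ANALYSIS ON `ℤ⁴` (decay classes, finite differences,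
finite tables, a shell count), kernel-checked.  It is LEAF 1 of the «log-free remainder» item left open in the header of
`Beta.PlaquetteStencil` («NOT PROVED HERE: any estimate or table value of the remainder vertex `remVertex₁`»): the abstract
mechanism by which a one-loop bubble whose two vertices carry at least THREE unit lattice differences in total contributes a
second moment that is bounded uniformly in the cutoff — no `log`, hence nothing to a one-loop coefficient read off the
logarithmic slope (`Beta.TransferUV.coeff_transfer_of_kernels`).  Value = β-function BOOKKEEPING made rigorous in position
space; NOT summit progress.

ABSOLUTE RULE.  No internally-minted statement may enter as a cited fact.  Every hypothesis is either kernel-proved in this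
package or a verbatim quotation of a PUBLISHED theorem with page reference.  The manuscript(s) under audit are NOT citable for
their own disputed steps — they are the thing under adjudication; programme-internal (2001/route/tribunal) claims are never
citable.  In this file NOTHING printed is used as a hypothesis: every statement is proved from the definitions.  Literature
named for CONTEXT only: the mechanism «a lattice operator of engineering dimension > 4 — extra lattice derivatives on the vertex —
is ultraviolet-finite at one loop and does not feed the logarithm» is the standard lattice power counting, printed in momentum
space as T. Reisz, *A power counting theorem for Feynman integrals on the lattice*, Commun. Math. Phys. **116** (1988) 81–126
[Reisz1988]; the vertices this leaf is built to serve are the `B`-linear one-bond germs of the Wilson action expanded around a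
background, T. Bałaban, *Propagators for lattice gauge theories in a background field*, Commun. Math. Phys. **99** (1985) 389–434
[Balaban1985BackgroundPropagators], pp. 391–392, (3.7)–(3.12), typed as finite stencils in `Beta.PlaquetteStencil`.  Neither is
cited as a hypothesis; the position-space statement below is PROVED, for abstract stencils and abstract leg families.

WHAT IS PROVED (all over `Pt = ℤ⁴` with the sup norm `supNorm`, legs indexed by the RG parameters `(L,k)`).

* §1 DECAY CLASSES.  `Fam := ℕ → ℕ → Pt → ℝ`; `IsO p f`: ONE constant bounds `|f L k w|` everywhere and by `A/‖w‖∞^p` off the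
  origin, uniformly in `(L,k)`.  Closure under `+`, scalars, reflection `w ↦ −w`, TRANSLATION by a fixed lattice vector
  (`IsO.shift`, constant `A·(2(‖a‖∞+1))^p`), and located products `c·f₁(α−w)·f₂(w+β) ∈ IsO (p₁+p₂)` (`IsO.locProd`).
* §2 DIFFERENCE BUDGETS.  Unit steps `IsStep a` (`a = ±e_i`), forward differences `fdiffF a h (w) = h(w+a) − h(w)`, iterated
  differences `iterD`, and `DG j p h`: `h ∈ IsO p` and every `m ≤ j` nested unit-step differences of `h` lie in `IsO (p+m)`;
  `DG` is stable under translation and loses one unit of budget per difference while gaining one power (`DG.fdiffF`).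
* §3 THE ANALYTIC BASE (`dg_three`).  For a two-power family `T : TwoPower` of `Beta.TwoPowerLegs` — (F1) `|g − c₄/|v|₂²| ≤ B/‖v‖∞⁴`,
  (F2) `|g| ≤ U` — with SHARP UNIT DIFFERENCES (F3) `SharpDiff T B₃`: `DG 3 2 T.g`, i.e. `g ∈ IsO 2` and its first / second /
  third unit-step differences lie in `IsO 3 / 4 / 5`, uniformly in `(L,k)`.  Proof: `g = c₄/|·|₂² + E`; the continuum part gains
  one power per difference up to order three by the Taylor bounds `taylor1/2/3_invSq` of `TwoPowerLegs` §1 and the cancellation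
  of the constant, linear and quadratic Taylor terms in the alternating 2-, 4- and 8-point sums (`isO_fdiffF_qF`,
  `isO_fdiffF_fdiffF_qF`, `isO_fdiffF_fdiffF_fdiffF_qF`); `E ∈ IsO 4` by (F1)(F2) and a unit difference of `E` is `IsO 5` by (F3)
  (steps `−e_i` by translation).  UNCONDITIONAL INSTANCE: the free legs `latticeGreen/2` (`dg_three_free`, from
  `TwoPowerLegs.free_sharp`).  (F1)–(F3) for Bałaban's `k`-th effective propagators are NOT proved here (rows an5/an1 of the cell).
* §4 STENCILS AND BUBBLES.  A located pair `LP I = (x, y, m)` (row site, column site, internal matrix over a finite index type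
  `I` = colour × direction), a stencil `Stn I = List (LP I)`, and the bubble of two stencils through legs `f₁, f₂` as the finite
  table `bub f₁ f₂ V W (w) = Σ_{p∈V,q∈W} tr(m_p m_q)·f₁(x_p − y_q − w)·f₂(w + x_q − y_p)` — the right-hand side of
  `Beta.BubbleTable.bubble_stencil_eq_table`, taken on `ℤ⁴` as a DEFINITION.  TRANSFER IDENTITIES (exact, by induction on the
  lists): a row translation of the first vertex / of the second vertex is a translation of the first / second leg; a column
  translation of the first / second vertex is a reversed translation of the second / first leg; hence a ROW or COLUMN
  DIFFERENCE `ρ_a V − V`, `σ_a V − V` of either vertex is a unit-step DIFFERENCE OF ONE LEG (`bub_rowDiff_left/right`,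
  `bub_colDiff_left/right`); bilinearity (`bub_append_*`, `bub_smul_*`, `bub_sub_leg₁/₂`).
* §5 GRADING AND THE DECAY THEOREM.  `Graded n V`: `V` is generated from arbitrary stencils by ≥ `n` nested unit-step row/column
  differences, translations, sums and scalars.  `isO_bub`: `Graded n₁ V → Graded n₂ W → DG j₁ p₁ f₁ → DG j₂ p₂ f₂ →
  bub f₁ f₂ V W ∈ IsO (p₁ + p₂ + min (min j₁ j₂) (n₁ + n₂))`.  With budgets `DG 3 2`: degree `4 + min 3 (n₁+n₂)` — 4 raw, 6 (the
  logarithmic order) with two vertex differences, **7 with three** (`isO_seven`, `isO_seven_twoPower` under (F1)–(F3),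
  `isO_seven_free` unconditionally).
* §6 COUNTING.  `sum_abs_moment_le`: `F ∈ IsO 7 ⇒ ∃ A, ∀ L k M μ ν, Σ_{0<‖z‖∞≤M} |z_μ z_ν F L k z| ≤ A` (shellwise `A₇/(r+1)⁵`
  against `#shell ≤ 80(r+1)³`, `TransferUV.abs_sum_le_of_quintic`).  **HEADLINE** `sum_abs_moment_bub_free_le`: a bubble of two
  graded stencils of total grading ≥ 3 through the free legs has second-moment partial sums bounded uniformly in the cutoff.

NOT PROVED HERE, NOT CLAIMED (LEAF 2 and beyond): the transcription of `PlaquetteStencil.remVertex₁` (grading ≥ 2: every term a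
difference of a difference or a transported difference), `SpinTable.vecVertex` / `PlaquetteStencil.divVertex` (grading ≥ 1) as
graded `ℤ⁴`-stencils and the resulting «remainder ⊗ anything is log-free» statement; the passage from the torus tables of
`BubbleTable` to `ℤ⁴`; (F1)–(F3) for Bałaban's propagators; the fate of the longitudinal vertex under gauge fixing; anything about
`BetaPertH`, the continuum limit or the Clay problem.  All declarations are tagged `[folklore]`: elementary analysis with no
printed input.  PLACEMENT: with the sibling an3 leaves under `Beta/` per the cell charter; imports `Beta.BlockLegs`,
`Beta.TransferUV` only.
-/

noncomputable section

namespace Literature.MathematicalPhysics.QuantumFieldTheory.Balaban1983to89.Beta.GradedBubbles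

open Finset
open Literature.Probability.LatticeModels (annulus)
open Literature.MathematicalPhysics.QuantumFieldTheory.Balaban1983to89
open Literature.MathematicalPhysics.QuantumFieldTheory.Balaban1983to89.Beta
open Literature.MathematicalPhysics.QuantumFieldTheory.Balaban1983to89.Beta.TransverseStructure
open Literature.MathematicalPhysics.QuantumFieldTheory.Balaban1983to89.Beta.DyadicShell
open Literature.MathematicalPhysics.QuantumFieldTheory.Balaban1983to89.Beta.BubbleTransfer
open Literature.MathematicalPhysics.QuantumFieldTheory.Balaban1983to89.Beta.TwoPowerLegs
open Literature.MathematicalPhysics.QuantumFieldTheory.Balaban1983to89.Beta.BlockLegs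

/-! ## §1. Uniform decay classes `IsO p` of `(L,k)`-families of lattice functions on `ℤ⁴` -/

/-- An `(L,k)`-FAMILY of real functions on the fluctuation lattice `ℤ⁴` (one function per RG parameter `L` and step `k`;
the free legs are constant families). [folklore] -/
abbrev Fam : Type := ℕ → ℕ → Pt → ℝ

/-- **UNIFORM DECAY OF DEGREE `p`**: `IsO p f` says that ONE constant `A ≥ 0`, free of `(L,k)`, bounds `|f L k w|`
for all `w` and bounds it by `A/‖w‖∞^p` for all `w ≠ 0`.  (Existential in `A`; the global bound makes the class stable
under translations.) [folklore] -/
def IsO (p : ℕ) (f : Fam) : Prop :=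
  ∃ A : ℝ, 0 ≤ A ∧ (∀ L k w, |f L k w| ≤ A) ∧ (∀ L k w, w ≠ 0 → |f L k w| ≤ A / (supNorm w : ℝ) ^ p)

/-- `‖−w‖∞ = ‖w‖∞`. [folklore] -/
theorem supNorm_neg (w : Pt) : supNorm (-w) = supNorm w := by
  unfold supNorm; simp

/-- The zero family decays at every degree. [folklore] -/
theorem isO_zero (p : ℕ) : IsO p 0 :=
  ⟨0, le_rfl, fun _ _ _ => by simp, fun _ _ _ _ => by simp⟩

namespace IsO

variable {p q : ℕ} {f g : Fam}

/-- Monotonicity in the degree (`‖w‖∞ ≥ 1` for `w ≠ 0`). [folklore] -/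
theorem mono (hf : IsO p f) (hq : q ≤ p) : IsO q f := by
  obtain ⟨A, hA, hglob, hdec⟩ := hf
  refine ⟨A, hA, hglob, fun L k w hw => (hdec L k w hw).trans ?_⟩
  have hs : (1 : ℝ) ≤ supNorm w := Leg.one_le_supNorm hw
  exact div_le_div_of_nonneg_left hA (by positivity) (pow_le_pow_right₀ hs hq)

/-- Sums. [folklore] -/
theorem add (hf : IsO p f) (hg : IsO p g) : IsO p (f + g) := by
  obtain ⟨A, hA, hfg, hfd⟩ := hf
  obtain ⟨B, hB, hgg, hgd⟩ := hg
  refine ⟨A + B, by positivity, fun L k w => ?_, fun L k w hw => ?_⟩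
  · exact (abs_add_le _ _).trans (add_le_add (hfg L k w) (hgg L k w))
  · rw [Pi.add_apply, Pi.add_apply, Pi.add_apply, add_div]
    exact (abs_add_le _ _).trans (add_le_add (hfd L k w hw) (hgd L k w hw))

/-- Scalar multiples. [folklore] -/
theorem smul (c : ℝ) (hf : IsO p f) : IsO p (c • f) := by
  obtain ⟨A, hA, hfg, hfd⟩ := hf
  refine ⟨|c| * A, by positivity, fun L k w => ?_, fun L k w hw => ?_⟩
  · rw [Pi.smul_apply, Pi.smul_apply, Pi.smul_apply, smul_eq_mul, abs_mul]
    exact mul_le_mul_of_nonneg_left (hfg L k w) (abs_nonneg c)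
  · rw [Pi.smul_apply, Pi.smul_apply, Pi.smul_apply, smul_eq_mul, abs_mul, mul_div_assoc]
    exact mul_le_mul_of_nonneg_left (hfd L k w hw) (abs_nonneg c)

/-- Negation. [folklore] -/
theorem neg (hf : IsO p f) : IsO p (-f) := by
  have h := hf.smul (-1); rwa [neg_one_smul] at h

/-- Differences. [folklore] -/
theorem sub (hf : IsO p f) (hg : IsO p g) : IsO p (f - g) := by
  rw [sub_eq_add_neg]; exact hf.add hg.neg

/-- Products: the degrees add. [folklore] -/
theorem mul (hf : IsO p f) (hg : IsO q g) : IsO (p + q) (f * g) := by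
  obtain ⟨A, hA, hfg, hfd⟩ := hf
  obtain ⟨B, hB, hgg, hgd⟩ := hg
  refine ⟨A * B, by positivity, fun L k w => ?_, fun L k w hw => ?_⟩
  · rw [Pi.mul_apply, Pi.mul_apply, Pi.mul_apply, abs_mul]
    exact mul_le_mul (hfg L k w) (hgg L k w) (abs_nonneg _) hA
  · rw [Pi.mul_apply, Pi.mul_apply, Pi.mul_apply, abs_mul, pow_add, ← div_mul_div_comm]
    exact mul_le_mul (hfd L k w hw) (hgd L k w hw) (abs_nonneg _) (div_nonneg hA (by positivity))

/-- Reflection `w ↦ −w`. [folklore] -/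
theorem reflect (hf : IsO p f) : IsO p (fun L k w => f L k (-w)) := by
  obtain ⟨A, hA, hfg, hfd⟩ := hf
  refine ⟨A, hA, fun L k w => hfg L k (-w), fun L k w hw => ?_⟩
  have h := hfd L k (-w) (neg_ne_zero.mpr hw)
  rwa [supNorm_neg] at h

/-- **TRANSLATION**: `w ↦ f(w + b)` decays at the same degree (constant `A·(2‖b‖∞+2)^p`). [folklore] -/
theorem shift (b : Pt) (hf : IsO p f) : IsO p (fun L k w => f L k (w + b)) := by
  obtain ⟨A, hA, hfg, hfd⟩ := hf
  set s : ℝ := (supNorm b : ℝ) with hs_def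
  have hs0 : 0 ≤ s := Nat.cast_nonneg _
  have hK1 : (1 : ℝ) ≤ (2 * s + 2) ^ p := one_le_pow₀ (by linarith)
  refine ⟨A * (2 * s + 2) ^ p, by positivity, fun L k w => ?_, fun L k w hw => ?_⟩
  · exact (hfg L k (w + b)).trans (le_mul_of_one_le_right hA hK1)
  · have hw1 : (1 : ℝ) ≤ supNorm w := Leg.one_le_supNorm hw
    have hwpos : (0 : ℝ) < supNorm w := by linarith
    by_cases hcase : 2 * s < supNorm w
    · -- far from `−b`: `‖w + b‖∞ ≥ ‖w‖∞/2`
      have hwb : (supNorm w : ℝ) - s ≤ supNorm (w + b) := supNorm_sub_le_supNorm_add w b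
      have hwbpos : (0 : ℝ) < supNorm (w + b) := by linarith
      have hne : w + b ≠ 0 := by
        intro h0; rw [h0] at hwbpos; simp [supNorm] at hwbpos
      refine (hfd L k (w + b) hne).trans ?_
      rw [div_le_div_iff₀ (by positivity) (by positivity)]
      have h2 : (supNorm w : ℝ) ≤ 2 * supNorm (w + b) := by linarith
      calc A * (supNorm w : ℝ) ^ p ≤ A * (2 * supNorm (w + b)) ^ p :=
            mul_le_mul_of_nonneg_left (pow_le_pow_left₀ hwpos.le h2 p) hA
        _ = A * 2 ^ p * (supNorm (w + b) : ℝ) ^ p := by rw [mul_pow]; ring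
        _ ≤ A * (2 * s + 2) ^ p * (supNorm (w + b) : ℝ) ^ p := by
            apply mul_le_mul_of_nonneg_right _ (by positivity)
            exact mul_le_mul_of_nonneg_left (pow_le_pow_left₀ (by norm_num) (by linarith) p) hA
    · -- close to `−b`: use the global bound and `‖w‖∞ ≤ 2‖b‖∞`
      replace hcase : (supNorm w : ℝ) ≤ 2 * s := not_lt.mp hcase
      refine (hfg L k (w + b)).trans ?_
      rw [le_div_iff₀ (by positivity)]
      calc A * (supNorm w : ℝ) ^ p ≤ A * (2 * s) ^ p := mul_le_mul_of_nonneg_left (pow_le_pow_left₀ hwpos.le hcase p) hA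
        _ ≤ A * (2 * s + 2) ^ p := mul_le_mul_of_nonneg_left (pow_le_pow_left₀ (by positivity) (by linarith) p) hA

/-- A located product `w ↦ c · f(x − w) · g(w + y)` of two decaying families decays with the sum of the degrees
(the elementary bubble term). [folklore] -/
theorem locProd (c : ℝ) (x y : Pt) (hf : IsO p f) (hg : IsO q g) :
    IsO (p + q) (fun L k w => c * (f L k (x - w) * g L k (w + y))) := by
  have h1 : IsO p (fun L k w => f L k (x - w)) := by
    have h := (hf.shift x).reflect
    refine (congrArg (IsO p) ?_).mp h
    funext L k w; rw [neg_add_eq_sub]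
  have h2 : IsO q (fun L k w => g L k (w + y)) := hg.shift y
  have h := (h1.mul h2).smul c
  refine (congrArg (IsO (p + q)) ?_).mp h
  funext L k w; simp [smul_eq_mul]

end IsO

/-! ## §2. Translates, unit-step differences, iterated differences, and the difference budget `DG j p` -/

/-- Translate of a family: `(shiftF b h)(w) = h(w + b)`. [folklore] -/
def shiftF (b : Pt) (h : Fam) : Fam := fun L k w => h L k (w + b)

/-- Forward difference of a family by the step `a`: `(fdiffF a h)(w) = h(w + a) − h(w)`. [folklore] -/
def fdiffF (a : Pt) (h : Fam) : Fam := fun L k w => h L k (w + a) - h L k w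

/-- A UNIT STEP: `±e_i`. [folklore] -/
def IsStep (a : Pt) : Prop := ∃ i : Fin 4, a = unitVec i ∨ a = -unitVec i

/-- `‖±e_i‖∞ = 1`. [folklore] -/
theorem IsStep.supNorm_eq {a : Pt} (ha : IsStep a) : supNorm a = 1 := by
  obtain ⟨i, rfl | rfl⟩ := ha
  · exact supNorm_unitVec i
  · exact supNorm_neg_unitVec i

/-- Unit steps are closed under negation. [folklore] -/
theorem IsStep.neg {a : Pt} (ha : IsStep a) : IsStep (-a) := by
  obtain ⟨i, rfl | rfl⟩ := ha
  · exact ⟨i, Or.inr rfl⟩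
  · exact ⟨i, Or.inl (neg_neg _)⟩

/-- Iterated forward differences along a list of steps: `iterD (a :: as) h = iterD as (fdiffF a h)`. [folklore] -/
def iterD : List Pt → Fam → Fam
  | [], h => h
  | a :: as, h => iterD as (fdiffF a h)

/-- **THE DIFFERENCE BUDGET `DG j p h`**: `h` decays at degree `p`, and every `i ≤ j` further unit-step differences
decay at degree `p + i` — each of the next `j` differences GAINS one power. [folklore] -/
def DG (j p : ℕ) (h : Fam) : Prop :=
  ∀ as : List Pt, as.length ≤ j → (∀ a ∈ as, IsStep a) → IsO (p + as.length) (iterD as h)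

/-- A translate of a difference is the difference of the translate. [folklore] -/
theorem fdiffF_shiftF (a b : Pt) (h : Fam) : fdiffF a (shiftF b h) = shiftF b (fdiffF a h) := by
  funext L k w; simp only [fdiffF, shiftF, add_right_comm]

/-- Iterated differences commute with translation. [folklore] -/
theorem iterD_shiftF (as : List Pt) (b : Pt) (h : Fam) : iterD as (shiftF b h) = shiftF b (iterD as h) := by
  induction as generalizing h with
  | nil => rfl
  | cons a as ih => simp only [iterD, fdiffF_shiftF, ih]

/-- A difference of a degree-`p` family has degree (at least) `p` — no gain claimed. [folklore] -/
theorem IsO.fdiffF {p : ℕ} {h : Fam} (a : Pt) (hh : IsO p h) : IsO p (fdiffF a h) := by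
  have := (hh.shift a).sub hh
  refine (congrArg (IsO p) ?_).mp this
  funext L k w; rfl

/-- `shiftF` preserves `IsO`. [folklore] -/
theorem IsO.shiftF {p : ℕ} {h : Fam} (b : Pt) (hh : IsO p h) : IsO p (shiftF b h) := hh.shift b

namespace DG

variable {j p : ℕ} {h : Fam}

/-- The budget-`0` reading: `h` itself decays at degree `p`. [folklore] -/
theorem isO (hh : DG j p h) : IsO p h := by
  have := hh [] (by simp) (by simp)
  simpa [iterD] using this

/-- Translation keeps the budget. [folklore] -/
theorem shiftF (b : Pt) (hh : DG j p h) : DG j p (shiftF b h) := by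
  intro as hlen hstep
  rw [iterD_shiftF]
  exact (hh as hlen hstep).shiftF b

/-- Lowering the claimed degree keeps the budget. [folklore] -/
theorem mono {q : ℕ} (hh : DG j p h) (hq : q ≤ p) : DG j q h := by
  intro as hlen hstep
  exact (hh as hlen hstep).mono (by omega)

/-- **SPENDING ONE UNIT OF BUDGET**: a unit-step difference of a `DG j p` family is `DG (j−1) (p + min j 1)` — it
gains one power of decay if `j ≥ 1` and loses nothing if `j = 0`. [folklore] -/
theorem fdiffF {a : Pt} (ha : IsStep a) (hh : DG j p h) : DG (j - 1) (p + min j 1) (fdiffF a h) := by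
  intro as hlen hstep
  rcases Nat.eq_zero_or_pos j with hj | hj
  · subst hj
    have hnil : as = [] := List.eq_nil_of_length_eq_zero (by omega)
    subst hnil
    simpa [iterD] using (hh.isO).fdiffF a
  · have h := hh (a :: as) (by simp; omega) (by
      intro b hb
      rcases List.mem_cons.mp hb with rfl | hb
      · exact ha
      · exact hstep b hb)
    simp only [iterD, List.length_cons] at h
    refine h.mono ?_
    have : min j 1 = 1 := by omega
    omega

end DG

/-- Upgrading a decay degree FAR OUT: a family with some uniform bound (`IsO p₀`) whose values beyond radius `R` are
`≤ C/‖w‖∞^p` is `IsO p`. [folklore] -/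
theorem IsO.of_far {p p₀ : ℕ} {f : Fam} (h₀ : IsO p₀ f) {R C : ℝ} (hR : 1 ≤ R) (hC : 0 ≤ C)
    (hfar : ∀ L k w, R ≤ (supNorm w : ℝ) → |f L k w| ≤ C / (supNorm w : ℝ) ^ p) : IsO p f := by
  obtain ⟨A₀, hA₀, hglob, -⟩ := h₀
  refine ⟨A₀ * R ^ p + C, by positivity, fun L k w => (hglob L k w).trans ?_, fun L k w hw => ?_⟩
  · have : A₀ ≤ A₀ * R ^ p := le_mul_of_one_le_right hA₀ (one_le_pow₀ hR)
    linarith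
  · have hw1 : (1 : ℝ) ≤ supNorm w := Leg.one_le_supNorm hw
    have hwp : (0 : ℝ) < (supNorm w : ℝ) ^ p := by positivity
    by_cases hcase : R ≤ (supNorm w : ℝ)
    · refine (hfar L k w hcase).trans (div_le_div_of_nonneg_right ?_ hwp.le)
      have : 0 ≤ A₀ * R ^ p := by positivity
      linarith
    · replace hcase : (supNorm w : ℝ) ≤ R := (not_le.mp hcase).le
      refine (hglob L k w).trans ?_
      rw [le_div_iff₀ hwp]
      calc A₀ * (supNorm w : ℝ) ^ p ≤ A₀ * R ^ p := mul_le_mul_of_nonneg_left (pow_le_pow_left₀ (by positivity) hcase p) hA₀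
        _ ≤ A₀ * R ^ p + C := by linarith

/-- `fdiffF` is additive in the family. [folklore] -/
theorem fdiffF_add (a : Pt) (f g : Fam) : fdiffF a (f + g) = fdiffF a f + fdiffF a g := by
  funext L k w; simp only [fdiffF, Pi.add_apply]; ring

/-! ## §3. The analytic base: a (F1)+(F2) family with SHARP unit differences (F3) has difference budget `DG 3 2`

The family `g` is split as `c₄/|·|₂² + E`.  The continuum part gains one power per difference up to order three by the
Taylor bounds of `Beta.TwoPowerLegs` §1 (`taylor1_invSq`, `taylor2_invSq`, `taylor3_invSq`) and the cancellation of the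
constant / linear / quadratic Taylor terms in the alternating 2-, 4- and 8-point sums; the error `E` is `O(‖v‖∞⁻⁴)` by
(F1) and its unit differences are `O(‖v‖∞⁻⁵)` by (F3), after which further differences are taken crudely. -/

section Base

variable (T : TwoPower)

/-- The continuum part `c₄/|v|₂²` as a (constant) family. [folklore] -/
def qF : Fam := fun _ _ v => c4 * invSq (toReal v)

/-- The error part `E = g − c₄/|·|₂²` of the family. [folklore] -/
def EF : Fam := fun L k v => T.g L k v - c4 * invSq (toReal v)

/-- `g = c₄/|·|₂² + E`. [folklore] -/
theorem g_eq_qF_add_EF : (T.g : Fam) = qF + EF T := by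
  funext L k v; simp [qF, EF]

/-- A unit step has real sup-norm `1`. [folklore] -/
theorem IsStep.norm_toReal_eq {a : Pt} (ha : IsStep a) : ‖toReal a‖ = 1 := by
  rw [DyadicShell.norm_toReal, ha.supNorm_eq, Nat.cast_one]

/-- `toReal v ≠ 0` and `‖toReal v‖ = ‖v‖∞ ≥ R` for `‖v‖∞ ≥ R ≥ 1`. [folklore] -/
theorem toReal_ne_zero_of_le {R : ℝ} (hR : 0 < R) {v : Pt} (hv : R ≤ (supNorm v : ℝ)) : toReal v ≠ 0 := by
  intro h
  rw [toReal_eq_zero_iff] at h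
  subst h
  simp [supNorm] at hv
  linarith

/-- **ORDER 0**: `c₄/|v|₂²` is `IsO 2`. [folklore] -/
theorem isO_qF : IsO 2 qF := by
  refine ⟨c4, c4_pos.le, fun L k w => abs_c4_invSq_le w, fun L k w hw => ?_⟩
  exact freeLeg.lead w hw

/-- The linear Taylor term of `|x|⁻²` is additive in the increment. [folklore] -/
theorem lin_add (X ζ ζ' : E4) :
    ∑ μ, (ζ + ζ') μ * d1InvSq μ X = ∑ μ, ζ μ * d1InvSq μ X + ∑ μ, ζ' μ * d1InvSq μ X := by
  rw [← Finset.sum_add_distrib]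
  exact Finset.sum_congr rfl fun μ _ => by rw [Pi.add_apply]; ring

/-- The bilinear Hessian pairing of `|x|⁻²`. [folklore] -/
def qb (X ζ ζ' : E4) : ℝ := ∑ a, ∑ b, ζ a * ζ' b * hessInvSq a b X

/-- Additivity of `qb` in the first slot. [folklore] -/
theorem qb_add_left (X ζ₁ ζ₂ ζ' : E4) : qb X (ζ₁ + ζ₂) ζ' = qb X ζ₁ ζ' + qb X ζ₂ ζ' := by
  simp only [qb, ← Finset.sum_add_distrib]
  exact Finset.sum_congr rfl fun a _ => Finset.sum_congr rfl fun b _ => by rw [Pi.add_apply]; ring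

/-- Additivity of `qb` in the second slot. [folklore] -/
theorem qb_add_right (X ζ ζ₁ ζ₂ : E4) : qb X ζ (ζ₁ + ζ₂) = qb X ζ ζ₁ + qb X ζ ζ₂ := by
  simp only [qb, ← Finset.sum_add_distrib]
  exact Finset.sum_congr rfl fun a _ => Finset.sum_congr rfl fun b _ => by rw [Pi.add_apply]; ring

/-- The quadratic Taylor term is `½ qb X ζ ζ`. [folklore] -/
theorem quad_eq_qb (X ζ : E4) : (1 / 2) * ∑ a, ∑ b, ζ a * ζ b * hessInvSq a b X = (1 / 2) * qb X ζ ζ := rfl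

/-- **ORDER 1**: a unit-step difference of `c₄/|v|₂²` is `IsO 3`. [folklore] -/
theorem isO_fdiffF_qF {a : Pt} (ha : IsStep a) : IsO 3 (fdiffF a qF) := by
  refine (isO_qF.fdiffF a).of_far (R := 2) (C := c4 * 64) (by norm_num) (by have := c4_pos.le; positivity) ?_
  intro L k v hv
  have hX : toReal v ≠ 0 := toReal_ne_zero_of_le (by norm_num) hv
  have hXn : ‖toReal v‖ = (supNorm v : ℝ) := norm_toReal v
  have hζ : ‖toReal a‖ = 1 := ha.norm_toReal_eq
  have h2 : 2 * ‖toReal a‖ ≤ ‖toReal v‖ := by rw [hζ, hXn]; linarith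
  have ht := taylor1_invSq hX h2
  rw [hζ, hXn] at ht
  have e : fdiffF a qF L k v = c4 * (invSq (toReal v + toReal a) - invSq (toReal v)) := by
    simp only [fdiffF, qF, toReal_add]; ring
  rw [e, abs_mul, abs_of_pos c4_pos, mul_div_assoc]
  exact mul_le_mul_of_nonneg_left (by simpa using ht) c4_pos.le

/-- **ORDER 2**: a double unit-step difference of `c₄/|v|₂²` is `IsO 4` (constant and linear Taylor terms cancel in the
4-point alternating sum). [folklore] -/
theorem isO_fdiffF_fdiffF_qF {a b : Pt} (ha : IsStep a) (hb : IsStep b) : IsO 4 (fdiffF b (fdiffF a qF)) := by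
  refine ((isO_qF.fdiffF a).fdiffF b).of_far (R := 4) (C := c4 * 1344) (by norm_num)
    (by have := c4_pos.le; positivity) ?_
  intro L k v hv
  set X := toReal v with hXdef
  set α := toReal a with hαdef
  set β := toReal b with hβdef
  have hX : X ≠ 0 := toReal_ne_zero_of_le (by norm_num) hv
  have hXn : ‖X‖ = (supNorm v : ℝ) := norm_toReal v
  have hα : ‖α‖ = 1 := ha.norm_toReal_eq
  have hβ : ‖β‖ = 1 := hb.norm_toReal_eq
  have hβα : ‖β + α‖ ≤ 2 := (norm_add_le _ _).trans (by rw [hα, hβ]; norm_num)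
  set lin : E4 → ℝ := fun ζ => ∑ μ, ζ μ * d1InvSq μ X with hlin
  have key : ∀ ζ : E4, ‖ζ‖ ≤ 2 → |invSq (X + ζ) - invSq X - lin ζ| ≤ 112 * 4 / ‖X‖ ^ 4 := by
    intro ζ hζ
    have h2 : 2 * ‖ζ‖ ≤ ‖X‖ := by rw [hXn]; linarith
    refine (taylor2_invSq hX h2).trans ?_
    have hXp : 0 < ‖X‖ := norm_pos_iff.mpr hX
    apply div_le_div_of_nonneg_right _ (by positivity)
    nlinarith [norm_nonneg ζ]
  have hl : lin (β + α) = lin β + lin α := lin_add X β α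
  have e : fdiffF b (fdiffF a qF) L k v =
      c4 * ((invSq (X + (β + α)) - invSq X - lin (β + α)) - (invSq (X + β) - invSq X - lin β) -
        (invSq (X + α) - invSq X - lin α)) := by
    simp only [fdiffF, qF, toReal_add, ← hXdef, ← hαdef, ← hβdef, add_assoc]
    linear_combination c4 * hl
  rw [e, abs_mul, abs_of_pos c4_pos, mul_div_assoc]
  refine mul_le_mul_of_nonneg_left ?_ c4_pos.le
  have k1 := key (β + α) hβα
  have k2 := key β (by rw [hβ]; norm_num)
  have k3 := key α (by rw [hα]; norm_num)
  rw [hXn] at k1 k2 k3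
  have tri : ∀ x y z : ℝ, |x - y - z| ≤ |x| + |y| + |z| := fun x y z => by
    have := abs_sub (x - y) z; have := abs_sub x y; linarith
  calc |invSq (X + (β + α)) - invSq X - lin (β + α) - (invSq (X + β) - invSq X - lin β) -
        (invSq (X + α) - invSq X - lin α)|
      ≤ |invSq (X + (β + α)) - invSq X - lin (β + α)| + |invSq (X + β) - invSq X - lin β| +
        |invSq (X + α) - invSq X - lin α| := tri _ _ _
    _ ≤ 112 * 4 / (supNorm v : ℝ) ^ 4 + 112 * 4 / (supNorm v : ℝ) ^ 4 + 112 * 4 / (supNorm v : ℝ) ^ 4 :=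
          add_le_add (add_le_add k1 k2) k3
    _ = 1344 / (supNorm v : ℝ) ^ 4 := by ring

/-- **ORDER 3**: a triple unit-step difference of `c₄/|v|₂²` is `IsO 5` (constant, linear and quadratic Taylor terms
cancel in the 8-point alternating sum). [folklore] -/
theorem isO_fdiffF_fdiffF_fdiffF_qF {a b c : Pt} (ha : IsStep a) (hb : IsStep b) (hc : IsStep c) :
    IsO 5 (fdiffF c (fdiffF b (fdiffF a qF))) := by
  refine (((isO_qF.fdiffF a).fdiffF b).fdiffF c).of_far (R := 6) (C := c4 * 701568) (by norm_num)
    (by have := c4_pos.le; positivity) ?_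
  intro L k v hv
  set X := toReal v with hXdef
  set α := toReal a with hαdef
  set β := toReal b with hβdef
  set γ := toReal c with hγdef
  have hX : X ≠ 0 := toReal_ne_zero_of_le (by norm_num) hv
  have hXn : ‖X‖ = (supNorm v : ℝ) := norm_toReal v
  have hα : ‖α‖ = 1 := ha.norm_toReal_eq
  have hβ : ‖β‖ = 1 := hb.norm_toReal_eq
  have hγ : ‖γ‖ = 1 := hc.norm_toReal_eq
  set lin : E4 → ℝ := fun ζ => ∑ μ, ζ μ * d1InvSq μ X with hlin
  set quad : E4 → ℝ := fun ζ => (1 / 2) * qb X ζ ζ with hquad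
  have key : ∀ ζ : E4, ‖ζ‖ ≤ 3 → |invSq (X + ζ) - invSq X - lin ζ - quad ζ| ≤ 3712 * 27 / ‖X‖ ^ 5 := by
    intro ζ hζ
    have h2 : 2 * ‖ζ‖ ≤ ‖X‖ := by rw [hXn]; linarith
    have ht := taylor3_invSq hX h2
    rw [quad_eq_qb] at ht
    refine ht.trans ?_
    have hXp : 0 < ‖X‖ := norm_pos_iff.mpr hX
    apply div_le_div_of_nonneg_right _ (by positivity)
    have h3 : ‖ζ‖ ^ 3 ≤ 3 ^ 3 := pow_le_pow_left₀ (norm_nonneg ζ) hζ 3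
    nlinarith
  -- additivity of the linear and quadratic Taylor terms
  have hl : ∀ ζ ζ' : E4, lin (ζ + ζ') = lin ζ + lin ζ' := fun ζ ζ' => lin_add X ζ ζ'
  have hq : ∀ ζ ζ' : E4, quad (ζ + ζ') = quad ζ + quad ζ' + qb X ζ ζ' / 2 + qb X ζ' ζ / 2 := by
    intro ζ ζ'
    simp only [hquad, qb_add_left, qb_add_right]; ring
  have e : fdiffF c (fdiffF b (fdiffF a qF)) L k v =
      c4 * ((invSq (X + (γ + β + α)) - invSq X - lin (γ + β + α) - quad (γ + β + α))
        - (invSq (X + (γ + β)) - invSq X - lin (γ + β) - quad (γ + β))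
        - (invSq (X + (γ + α)) - invSq X - lin (γ + α) - quad (γ + α))
        + (invSq (X + γ) - invSq X - lin γ - quad γ)
        - (invSq (X + (β + α)) - invSq X - lin (β + α) - quad (β + α))
        + (invSq (X + β) - invSq X - lin β - quad β)
        + (invSq (X + α) - invSq X - lin α - quad α)) := by
    have e0 : fdiffF c (fdiffF b (fdiffF a qF)) L k v =
        c4 * (invSq (X + (γ + β + α)) - invSq (X + (γ + β)) - invSq (X + (γ + α)) + invSq (X + γ)
          - invSq (X + (β + α)) + invSq (X + β) + invSq (X + α) - invSq X) := by
      simp only [fdiffF, qF, toReal_add, ← hXdef, ← hαdef, ← hβdef, ← hγdef]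
      have e1 : X + γ + β + α = X + (γ + β + α) := by abel
      have e2 : X + γ + β = X + (γ + β) := by abel
      have e3 : X + γ + α = X + (γ + α) := by abel
      have e4 : X + β + α = X + (β + α) := by abel
      rw [e1, e2, e3, e4]; ring
    rw [e0]
    have l1 := hl (γ + β) α; have l2 := hl γ β; have l3 := hl γ α; have l4 := hl β α
    have q1 := hq (γ + β) α; have q2 := hq γ β; have q3 := hq γ α; have q4 := hq β α
    rw [qb_add_left] at q1; rw [qb_add_right] at q1
    linear_combination c4 * (l1 - l3 - l4) + c4 * (q1 - q3 - q4)
  rw [e, abs_mul, abs_of_pos c4_pos, mul_div_assoc]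
  refine mul_le_mul_of_nonneg_left ?_ c4_pos.le
  have n3 : ‖γ + β + α‖ ≤ 3 := by
    refine (norm_add_le _ _).trans ?_
    have := norm_add_le γ β; rw [hα]; linarith [hβ, hγ]
  have n2a : ‖γ + β‖ ≤ 3 := (norm_add_le _ _).trans (by rw [hγ, hβ]; norm_num)
  have n2b : ‖γ + α‖ ≤ 3 := (norm_add_le _ _).trans (by rw [hγ, hα]; norm_num)
  have n2c : ‖β + α‖ ≤ 3 := (norm_add_le _ _).trans (by rw [hβ, hα]; norm_num)
  have k1 := key _ n3
  have k2 := key _ n2a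
  have k3 := key _ n2b
  have k4 := key γ (by rw [hγ]; norm_num)
  have k5 := key _ n2c
  have k6 := key β (by rw [hβ]; norm_num)
  have k7 := key α (by rw [hα]; norm_num)
  rw [hXn] at k1 k2 k3 k4 k5 k6 k7
  have hsum : (3712 * 27 : ℝ) / (supNorm v : ℝ) ^ 5 * 7 = 701568 / (supNorm v : ℝ) ^ 5 := by ring
  rw [← hsum]
  -- triangle inequality over the seven Taylor remainders
  have tri : ∀ x₁ x₂ x₃ x₄ x₅ x₆ x₇ : ℝ,
      |x₁ - x₂ - x₃ + x₄ - x₅ + x₆ + x₇| ≤ |x₁| + |x₂| + |x₃| + |x₄| + |x₅| + |x₆| + |x₇| := by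
    intro x₁ x₂ x₃ x₄ x₅ x₆ x₇
    have := abs_add_le (x₁ - x₂ - x₃ + x₄ - x₅ + x₆) x₇
    have := abs_add_le (x₁ - x₂ - x₃ + x₄ - x₅) x₆
    have := abs_sub (x₁ - x₂ - x₃ + x₄) x₅
    have := abs_add_le (x₁ - x₂ - x₃) x₄
    have := abs_sub (x₁ - x₂) x₃
    have := abs_sub x₁ x₂
    linarith
  refine (tri _ _ _ _ _ _ _).trans ?_
  linarith

/-- **THE ERROR PART IS `IsO 4`** ((F1) far out, (F2) and `|c₄/|v|₂²| ≤ c₄` globally). [folklore] -/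
theorem isO_EF : IsO 4 (EF T) := by
  refine ⟨T.U + c4 + T.B, by have := T.nonneg_U; have := T.nonneg_B; have := c4_pos.le; positivity,
    fun L k w => ?_, fun L k w hw => ?_⟩
  · have h1 := T.bdd L k w
    have h2 := abs_c4_invSq_le w
    have := T.nonneg_B
    calc |EF T L k w| ≤ |T.g L k w| + |c4 * invSq (toReal w)| := abs_sub _ _
      _ ≤ T.U + c4 + T.B := by linarith
  · have hs : (1 : ℝ) ≤ supNorm w := Leg.one_le_supNorm hw
    refine (T.err4 L k w hw).trans (div_le_div_of_nonneg_right ?_ (by positivity))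
    have := T.nonneg_U; have := c4_pos.le; linarith

/-- **A SHARP UNIT DIFFERENCE OF THE ERROR PART IS `IsO 5`** — hypothesis (F3) `SharpDiff T B₃`, for the steps
`+e_i` verbatim and for `−e_i` by translation. [folklore] -/
theorem isO_fdiffF_EF {B₃ : ℝ} (hB : 0 ≤ B₃) (hT : SharpDiff T B₃) {a : Pt} (ha : IsStep a) :
    IsO 5 (fdiffF a (EF T)) := by
  have hplus : ∀ i : Fin 4, IsO 5 (fdiffF (unitVec i) (EF T)) := by
    intro i
    refine ((isO_EF T).fdiffF (unitVec i)).of_far (R := 1) (C := B₃) le_rfl hB ?_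
    intro L k v hv
    have hv0 : v ≠ 0 := by
      intro h; rw [h] at hv
      have h0 : (supNorm (0 : Pt) : ℝ) = 0 := by simp [supNorm]
      linarith
    have h := hT L k v hv0 i
    have e : fdiffF (unitVec i) (EF T) L k v =
        T.g L k (v + unitVec i) - T.g L k v - c4 * (invSq (toReal (v + unitVec i)) - invSq (toReal v)) := by
      simp only [fdiffF, EF]; ring
    rw [e]; exact h
  obtain ⟨i, rfl | rfl⟩ := ha
  · exact hplus i
  · have e : fdiffF (-unitVec i) (EF T) = -(shiftF (-unitVec i) (fdiffF (unitVec i) (EF T))) := by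
      funext L k v
      simp only [fdiffF, shiftF, Pi.neg_apply, neg_add_cancel_right]
      ring
    rw [e]
    exact ((hplus i).shiftF _).neg

/-- **THE ANALYTIC BASE**: a (F1)+(F2) family with sharp unit differences (F3) has difference budget `DG 3 2` — it is
`O(‖v‖∞⁻²)` and its first / second / third unit-step differences are `O(‖v‖∞⁻³)` / `O(‖v‖∞⁻⁴)` / `O(‖v‖∞⁻⁵)`,
uniformly in `(L,k)`. [folklore] -/
theorem dg_three {B₃ : ℝ} (hB : 0 ≤ B₃) (hT : SharpDiff T B₃) : DG 3 2 T.g := by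
  intro as hlen hstep
  match as, hlen, hstep with
  | [], _, _ =>
      show IsO (2 + 0) T.g
      rw [g_eq_qF_add_EF]
      exact isO_qF.add ((isO_EF T).mono (by norm_num))
  | [a], _, hstep =>
      have ha : IsStep a := hstep a (by simp)
      show IsO (2 + 1) (fdiffF a T.g)
      rw [g_eq_qF_add_EF, fdiffF_add]
      exact (isO_fdiffF_qF ha).add ((isO_fdiffF_EF T hB hT ha).mono (by norm_num))
  | [a, b], _, hstep =>
      have ha : IsStep a := hstep a (by simp)
      have hb : IsStep b := hstep b (by simp)
      show IsO (2 + 2) (fdiffF b (fdiffF a T.g))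
      rw [g_eq_qF_add_EF, fdiffF_add, fdiffF_add]
      exact (isO_fdiffF_fdiffF_qF ha hb).add (((isO_fdiffF_EF T hB hT ha).fdiffF b).mono (by norm_num))
  | [a, b, c], _, hstep =>
      have ha : IsStep a := hstep a (by simp)
      have hb : IsStep b := hstep b (by simp)
      have hc : IsStep c := hstep c (by simp)
      show IsO (2 + 3) (fdiffF c (fdiffF b (fdiffF a T.g)))
      rw [g_eq_qF_add_EF, fdiffF_add, fdiffF_add, fdiffF_add]
      exact (isO_fdiffF_fdiffF_fdiffF_qF ha hb hc).add (((isO_fdiffF_EF T hB hT ha).fdiffF b).fdiffF c)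
  | _ :: _ :: _ :: _ :: _, hlen, _ => exact absurd hlen (by simp)

/-- **THE FREE RUNG, UNCONDITIONALLY**: the free family `latticeGreen/2` has budget `DG 3 2` (lit1-g5's sharp
differences `TwoPowerLegs.free_sharp` through the tree; nothing is assumed). [folklore] -/
theorem dg_three_free : DG 3 2 free.g :=
  dg_three free (Classical.choose_spec free_sharp).1 (Classical.choose_spec free_sharp).2

end Base

/-! ## §4. Located-pair stencils on `ℤ⁴`, their bubbles through two leg families, and the transfer identities

A first-order vertex of a local lattice operator at a background bond is a finite combination of LOCATED PAIRS
`(x, y, m)` — the matrix unit at the pair of fluctuation sites `(x, y)` tensored with an internal matrix `m` (colour ×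
direction; `Beta.BubbleTable.elemIns x y m`, `Beta.PlaquetteStencil.pairIns`).  On `ℤ⁴` we keep only this list and define
the bubble through two translation-invariant scalar legs `f₁, f₂` directly as the finite table
`Σ_{p,q} trace(m_p m_q) · f₁(x_p − y_q − w) · f₂(w + (x_q − y_p))` — the right-hand side of the table theorem
`Beta.BubbleTable.bubble_stencil_eq_table` (there on a finite torus; here a definition on `ℤ⁴`). -/

section Stencil

variable {I : Type*} [Fintype I]

/-- A LOCATED PAIR: row site `x`, column site `y`, internal coefficient matrix `m`. [folklore] -/
structure LP (I : Type*) where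
  /-- row site -/
  x : Pt
  /-- column site -/
  y : Pt
  /-- internal (colour × direction) coefficient -/
  m : Matrix I I ℝ

/-- A STENCIL: a finite list of located pairs (duplicates allowed; it denotes their sum). [folklore] -/
abbrev Stn (I : Type*) : Type _ := List (LP I)

/-- The elementary bubble term of two located pairs through the legs `f₁` (row of `p` to column of `q`) and `f₂`
(row of `q` to column of `p`), as a function of the relative position `w` of the second vertex. [folklore] -/
def term (f₁ f₂ : Fam) (p q : LP I) : Fam :=
  fun L k w => (p.m * q.m).trace * (f₁ L k (p.x - q.y - w) * f₂ L k (w + (q.x - p.y)))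

/-- The bubble of ONE located pair against a stencil. [folklore] -/
def bubRow (f₁ f₂ : Fam) (p : LP I) : Stn I → Fam
  | [] => 0
  | q :: W => term f₁ f₂ p q + bubRow f₁ f₂ p W

/-- **THE BUBBLE** of two stencils (first at the origin bond, second at relative position `w`) through the legs
`f₁, f₂`: the finite table `Σ_{p∈V} Σ_{q∈W} trace(m_p m_q)·f₁(x_p − y_q − w)·f₂(w + x_q − y_p)`. [folklore] -/
def bub (f₁ f₂ : Fam) : Stn I → Stn I → Fam
  | [], _ => 0
  | p :: V, W => bubRow f₁ f₂ p W + bub f₁ f₂ V W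

/-- Row translation of a stencil by `a`. [folklore] -/
def rowSh (a : Pt) (V : Stn I) : Stn I := V.map fun p => ⟨p.x + a, p.y, p.m⟩

/-- Column translation of a stencil by `a`. [folklore] -/
def colSh (a : Pt) (V : Stn I) : Stn I := V.map fun p => ⟨p.x, p.y + a, p.m⟩

/-- Scalar multiple of a stencil. [folklore] -/
def smulS (c : ℝ) (V : Stn I) : Stn I := V.map fun p => ⟨p.x, p.y, c • p.m⟩

/-- ROW DIFFERENCE `ρ_a V − V`. [folklore] -/
def rowDiff (a : Pt) (V : Stn I) : Stn I := rowSh a V ++ smulS (-1) V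

/-- COLUMN DIFFERENCE `σ_a V − V`. [folklore] -/
def colDiff (a : Pt) (V : Stn I) : Stn I := colSh a V ++ smulS (-1) V

variable (f₁ f₂ : Fam)

/-- `bubRow` is additive in the stencil. [folklore] -/
theorem bubRow_append (p : LP I) (W W' : Stn I) :
    bubRow f₁ f₂ p (W ++ W') = bubRow f₁ f₂ p W + bubRow f₁ f₂ p W' := by
  induction W with
  | nil => simp [bubRow]
  | cons q W ih => simp [bubRow, ih, add_assoc]

/-- `bub` is additive in the first stencil. [folklore] -/
theorem bub_append_left (V V' W : Stn I) : bub f₁ f₂ (V ++ V') W = bub f₁ f₂ V W + bub f₁ f₂ V' W := by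
  induction V with
  | nil => simp [bub]
  | cons p V ih => simp [bub, ih, add_assoc]

/-- `bub` is additive in the second stencil. [folklore] -/
theorem bub_append_right (V W W' : Stn I) : bub f₁ f₂ V (W ++ W') = bub f₁ f₂ V W + bub f₁ f₂ V W' := by
  induction V with
  | nil => simp [bub]
  | cons p V ih => simp only [bub, ih, bubRow_append]; abel

/-- Scalars in the first slot of a term. [folklore] -/
theorem term_smul_left (c : ℝ) (p q : LP I) : term f₁ f₂ ⟨p.x, p.y, c • p.m⟩ q = c • term f₁ f₂ p q := by
  funext L k w; simp [term, Matrix.smul_mul, Matrix.trace_smul, mul_assoc]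

/-- Scalars in the second slot of a term. [folklore] -/
theorem term_smul_right (c : ℝ) (p q : LP I) : term f₁ f₂ p ⟨q.x, q.y, c • q.m⟩ = c • term f₁ f₂ p q := by
  funext L k w; simp [term, Matrix.mul_smul, Matrix.trace_smul, mul_assoc]

/-- `bub (c•V) W = c • bub V W`. [folklore] -/
theorem bub_smul_left (c : ℝ) (V W : Stn I) : bub f₁ f₂ (smulS c V) W = c • bub f₁ f₂ V W := by
  induction V with
  | nil => simp [bub, smulS]
  | cons p V ih =>
      have hrow : ∀ W : Stn I, bubRow f₁ f₂ ⟨p.x, p.y, c • p.m⟩ W = c • bubRow f₁ f₂ p W := by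
        intro W
        induction W with
        | nil => simp [bubRow]
        | cons q W ihW => simp [bubRow, ihW, term_smul_left, smul_add]
      simp only [smulS, List.map_cons, bub] at ih ⊢
      rw [hrow, ih, smul_add]

/-- `bub V (c•W) = c • bub V W`. [folklore] -/
theorem bub_smul_right (c : ℝ) (V W : Stn I) : bub f₁ f₂ V (smulS c W) = c • bub f₁ f₂ V W := by
  induction V with
  | nil => simp [bub]
  | cons p V ih =>
      have hrow : ∀ W : Stn I, bubRow f₁ f₂ p (smulS c W) = c • bubRow f₁ f₂ p W := by
        intro W
        induction W with
        | nil => simp [bubRow, smulS]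
        | cons q W ihW =>
            simp only [smulS, List.map_cons, bubRow] at ihW ⊢
            rw [term_smul_right, ihW, smul_add]
      simp only [bub]
      rw [hrow, ih, smul_add]

/-- **TRANSFER OF A ROW TRANSLATION OF THE FIRST VERTEX onto the first leg.** [folklore] -/
theorem bub_rowSh_left (a : Pt) (V W : Stn I) : bub f₁ f₂ (rowSh a V) W = bub (shiftF a f₁) f₂ V W := by
  induction V with
  | nil => simp [bub, rowSh]
  | cons p V ih =>
      have hrow : ∀ W : Stn I, bubRow f₁ f₂ ⟨p.x + a, p.y, p.m⟩ W = bubRow (shiftF a f₁) f₂ p W := by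
        intro W
        induction W with
        | nil => simp [bubRow]
        | cons q W ihW =>
            simp only [bubRow, ihW]
            congr 1
            funext L k w
            simp only [term, shiftF]
            rw [show p.x + a - q.y - w = p.x - q.y - w + a by abel]
      simp only [rowSh, List.map_cons, bub] at ih ⊢
      rw [hrow, ih]

/-- **TRANSFER OF A COLUMN TRANSLATION OF THE FIRST VERTEX onto the second leg (step reversed).** [folklore] -/
theorem bub_colSh_left (a : Pt) (V W : Stn I) : bub f₁ f₂ (colSh a V) W = bub f₁ (shiftF (-a) f₂) V W := by
  induction V with
  | nil => simp [bub, colSh]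
  | cons p V ih =>
      have hrow : ∀ W : Stn I, bubRow f₁ f₂ ⟨p.x, p.y + a, p.m⟩ W = bubRow f₁ (shiftF (-a) f₂) p W := by
        intro W
        induction W with
        | nil => simp [bubRow]
        | cons q W ihW =>
            simp only [bubRow, ihW]
            congr 1
            funext L k w
            simp only [term, shiftF]
            rw [show w + (q.x - (p.y + a)) = w + (q.x - p.y) + -a by abel]
      simp only [colSh, List.map_cons, bub] at ih ⊢
      rw [hrow, ih]

/-- **TRANSFER OF A ROW TRANSLATION OF THE SECOND VERTEX onto the second leg.** [folklore] -/
theorem bub_rowSh_right (a : Pt) (V W : Stn I) : bub f₁ f₂ V (rowSh a W) = bub f₁ (shiftF a f₂) V W := by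
  induction V with
  | nil => simp [bub]
  | cons p V ih =>
      have hrow : ∀ W : Stn I, bubRow f₁ f₂ p (rowSh a W) = bubRow f₁ (shiftF a f₂) p W := by
        intro W
        induction W with
        | nil => simp [bubRow, rowSh]
        | cons q W ihW =>
            simp only [rowSh, List.map_cons, bubRow] at ihW ⊢
            rw [ihW]
            congr 1
            funext L k w
            simp only [term, shiftF]
            rw [show w + (q.x + a - p.y) = w + (q.x - p.y) + a by abel]
      simp only [bub]
      rw [hrow, ih]

/-- **TRANSFER OF A COLUMN TRANSLATION OF THE SECOND VERTEX onto the first leg (step reversed).** [folklore] -/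
theorem bub_colSh_right (a : Pt) (V W : Stn I) : bub f₁ f₂ V (colSh a W) = bub (shiftF (-a) f₁) f₂ V W := by
  induction V with
  | nil => simp [bub]
  | cons p V ih =>
      have hrow : ∀ W : Stn I, bubRow f₁ f₂ p (colSh a W) = bubRow (shiftF (-a) f₁) f₂ p W := by
        intro W
        induction W with
        | nil => simp [bubRow, colSh]
        | cons q W ihW =>
            simp only [colSh, List.map_cons, bubRow] at ihW ⊢
            rw [ihW]
            congr 1
            funext L k w
            simp only [term, shiftF]
            rw [show p.x - (q.y + a) - w = p.x - q.y - w + -a by abel]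
      simp only [bub]
      rw [hrow, ih]

/-- The bubble is additive in the first leg. [folklore] -/
theorem bub_sub_leg₁ (f f' f₂ : Fam) (V W : Stn I) : bub (f - f') f₂ V W = bub f f₂ V W - bub f' f₂ V W := by
  induction V with
  | nil => simp [bub]
  | cons p V ih =>
      have hrow : ∀ W : Stn I, bubRow (f - f') f₂ p W = bubRow f f₂ p W - bubRow f' f₂ p W := by
        intro W
        induction W with
        | nil => simp [bubRow]
        | cons q W ihW =>
            simp only [bubRow, ihW]
            have : term (f - f') f₂ p q = term f f₂ p q - term f' f₂ p q := by
              funext L k w; simp only [term, Pi.sub_apply]; ring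
            rw [this]; abel
      simp only [bub, hrow, ih]; abel

/-- The bubble is additive in the second leg. [folklore] -/
theorem bub_sub_leg₂ (f₁ f f' : Fam) (V W : Stn I) : bub f₁ (f - f') V W = bub f₁ f V W - bub f₁ f' V W := by
  induction V with
  | nil => simp [bub]
  | cons p V ih =>
      have hrow : ∀ W : Stn I, bubRow f₁ (f - f') p W = bubRow f₁ f p W - bubRow f₁ f' p W := by
        intro W
        induction W with
        | nil => simp [bubRow]
        | cons q W ihW =>
            simp only [bubRow, ihW]
            have : term f₁ (f - f') p q = term f₁ f p q - term f₁ f' p q := by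
              funext L k w; simp only [term, Pi.sub_apply]; ring
            rw [this]; abel
      simp only [bub, hrow, ih]; abel

/-- `fdiffF a f = shiftF a f − f`. [folklore] -/
theorem fdiffF_eq_shiftF_sub (a : Pt) (f : Fam) : fdiffF a f = shiftF a f - f := by
  funext L k w; rfl

/-- **A ROW DIFFERENCE OF THE FIRST VERTEX IS A DIFFERENCE OF THE FIRST LEG.** [folklore] -/
theorem bub_rowDiff_left (a : Pt) (V W : Stn I) : bub f₁ f₂ (rowDiff a V) W = bub (fdiffF a f₁) f₂ V W := by
  rw [rowDiff, bub_append_left, bub_rowSh_left, bub_smul_left, fdiffF_eq_shiftF_sub, bub_sub_leg₁, neg_one_smul,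
    sub_eq_add_neg]

/-- **A COLUMN DIFFERENCE OF THE FIRST VERTEX IS A (reversed) DIFFERENCE OF THE SECOND LEG.** [folklore] -/
theorem bub_colDiff_left (a : Pt) (V W : Stn I) : bub f₁ f₂ (colDiff a V) W = bub f₁ (fdiffF (-a) f₂) V W := by
  rw [colDiff, bub_append_left, bub_colSh_left, bub_smul_left, fdiffF_eq_shiftF_sub, bub_sub_leg₂, neg_one_smul,
    sub_eq_add_neg]

/-- **A ROW DIFFERENCE OF THE SECOND VERTEX IS A DIFFERENCE OF THE SECOND LEG.** [folklore] -/
theorem bub_rowDiff_right (a : Pt) (V W : Stn I) : bub f₁ f₂ V (rowDiff a W) = bub f₁ (fdiffF a f₂) V W := by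
  rw [rowDiff, bub_append_right, bub_rowSh_right, bub_smul_right, fdiffF_eq_shiftF_sub, bub_sub_leg₂, neg_one_smul,
    sub_eq_add_neg]

/-- **A COLUMN DIFFERENCE OF THE SECOND VERTEX IS A (reversed) DIFFERENCE OF THE FIRST LEG.** [folklore] -/
theorem bub_colDiff_right (a : Pt) (V W : Stn I) : bub f₁ f₂ V (colDiff a W) = bub (fdiffF (-a) f₁) f₂ V W := by
  rw [colDiff, bub_append_right, bub_colSh_right, bub_smul_right, fdiffF_eq_shiftF_sub, bub_sub_leg₁, neg_one_smul,
    sub_eq_add_neg]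

/-- **THE RAW TABLE BOUND** (no grading): a bubble through legs of degrees `p₁, p₂` is `IsO (p₁ + p₂)`. [folklore] -/
theorem isO_bub_base {p₁ p₂ : ℕ} {f₁ f₂ : Fam} (h₁ : IsO p₁ f₁) (h₂ : IsO p₂ f₂) (V W : Stn I) :
    IsO (p₁ + p₂) (bub f₁ f₂ V W) := by
  induction V with
  | nil => simpa [bub] using isO_zero (p₁ + p₂)
  | cons p V ih =>
      have hrow : ∀ W : Stn I, IsO (p₁ + p₂) (bubRow f₁ f₂ p W) := by
        intro W
        induction W with
        | nil => simpa [bubRow] using isO_zero (p₁ + p₂)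
        | cons q W ihW =>
            simp only [bubRow]
            exact (IsO.locProd ((p.m * q.m).trace) (p.x - q.y) (q.x - p.y) h₁ h₂).add ihW
      simp only [bub]
      exact (hrow W).add ih

/-! ## §5. GRADED stencils and the decay theorem -/

/-- **GRADING**: `Graded n V` — the stencil `V` is built from arbitrary stencils by AT LEAST `n` nested unit-step
row/column differences, closed under translations, concatenation (= sum) and scalars; `weaken` forgets a difference.
(A joint translation difference `τ_a V − V` is `rowDiff a (colSh a V) ++ colDiff a V`, hence also graded.) [folklore] -/
inductive Graded : ℕ → Stn I → Prop
  | zero (V : Stn I) : Graded 0 V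
  | weaken {n : ℕ} {V : Stn I} : Graded (n + 1) V → Graded n V
  | rowDiff {n : ℕ} {V : Stn I} {a : Pt} : IsStep a → Graded n V → Graded (n + 1) (rowDiff a V)
  | colDiff {n : ℕ} {V : Stn I} {a : Pt} : IsStep a → Graded n V → Graded (n + 1) (colDiff a V)
  | rowSh {n : ℕ} {V : Stn I} (a : Pt) : Graded n V → Graded n (rowSh a V)
  | colSh {n : ℕ} {V : Stn I} (a : Pt) : Graded n V → Graded n (colSh a V)
  | append {n : ℕ} {V W : Stn I} : Graded n V → Graded n W → Graded n (V ++ W)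
  | smul {n : ℕ} {V : Stn I} (c : ℝ) : Graded n V → Graded n (smulS c V)

/-- The decay theorem with only the SECOND vertex graded (inner induction). [folklore] -/
theorem isO_bub_right (V : Stn I) {n₂ : ℕ} {W : Stn I} (hW : Graded n₂ W) :
    ∀ {j₁ j₂ p₁ p₂ : ℕ} {f₁ f₂ : Fam}, DG j₁ p₁ f₁ → DG j₂ p₂ f₂ →
      IsO (p₁ + p₂ + min (min j₁ j₂) n₂) (bub f₁ f₂ V W) := by
  induction hW with
  | zero W =>
      intro j₁ j₂ p₁ p₂ f₁ f₂ h₁ h₂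
      exact (isO_bub_base h₁.isO h₂.isO V W).mono (by omega)
  | weaken _ ih =>
      intro j₁ j₂ p₁ p₂ f₁ f₂ h₁ h₂
      exact (ih h₁ h₂).mono (by omega)
  | rowDiff ha _ ih =>
      intro j₁ j₂ p₁ p₂ f₁ f₂ h₁ h₂
      rw [bub_rowDiff_right]
      exact (ih h₁ (h₂.fdiffF ha)).mono (by omega)
  | colDiff ha _ ih =>
      intro j₁ j₂ p₁ p₂ f₁ f₂ h₁ h₂
      rw [bub_colDiff_right]
      exact (ih (h₁.fdiffF ha.neg) h₂).mono (by omega)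
  | rowSh a _ ih =>
      intro j₁ j₂ p₁ p₂ f₁ f₂ h₁ h₂
      rw [bub_rowSh_right]
      exact ih h₁ (h₂.shiftF a)
  | colSh a _ ih =>
      intro j₁ j₂ p₁ p₂ f₁ f₂ h₁ h₂
      rw [bub_colSh_right]
      exact ih (h₁.shiftF (-a)) h₂
  | append _ _ ih₁ ih₂ =>
      intro j₁ j₂ p₁ p₂ f₁ f₂ h₁ h₂
      rw [bub_append_right]
      exact (ih₁ h₁ h₂).add (ih₂ h₁ h₂)
  | smul c _ ih =>
      intro j₁ j₂ p₁ p₂ f₁ f₂ h₁ h₂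
      rw [bub_smul_right]
      exact (ih h₁ h₂).smul c

/-- **THE DECAY THEOREM.**  If the two vertices carry gradings `n₁, n₂` and the legs have difference budgets
`DG j₁ p₁`, `DG j₂ p₂`, the bubble is `IsO (p₁ + p₂ + min (min j₁ j₂) (n₁ + n₂))`: every vertex difference is
transferred onto a leg (row of the first / column of the second vertex ↦ first leg, the other two ↦ second leg) and
gains one power while that leg's budget lasts. [folklore] -/
theorem isO_bub {n₁ : ℕ} {V : Stn I} (hV : Graded n₁ V) :
    ∀ {n₂ : ℕ} {W : Stn I}, Graded n₂ W → ∀ {j₁ j₂ p₁ p₂ : ℕ} {f₁ f₂ : Fam}, DG j₁ p₁ f₁ → DG j₂ p₂ f₂ →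
      IsO (p₁ + p₂ + min (min j₁ j₂) (n₁ + n₂)) (bub f₁ f₂ V W) := by
  induction hV with
  | zero V =>
      intro n₂ W hW j₁ j₂ p₁ p₂ f₁ f₂ h₁ h₂
      exact (isO_bub_right V hW h₁ h₂).mono (by omega)
  | weaken _ ih =>
      intro n₂ W hW j₁ j₂ p₁ p₂ f₁ f₂ h₁ h₂
      exact (ih hW h₁ h₂).mono (by omega)
  | rowDiff ha _ ih =>
      intro n₂ W hW j₁ j₂ p₁ p₂ f₁ f₂ h₁ h₂
      rw [bub_rowDiff_left]
      exact (ih hW (h₁.fdiffF ha) h₂).mono (by omega)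
  | colDiff ha _ ih =>
      intro n₂ W hW j₁ j₂ p₁ p₂ f₁ f₂ h₁ h₂
      rw [bub_colDiff_left]
      exact (ih hW h₁ (h₂.fdiffF ha.neg)).mono (by omega)
  | rowSh a _ ih =>
      intro n₂ W hW j₁ j₂ p₁ p₂ f₁ f₂ h₁ h₂
      rw [bub_rowSh_left]
      exact ih hW (h₁.shiftF a) h₂
  | colSh a _ ih =>
      intro n₂ W hW j₁ j₂ p₁ p₂ f₁ f₂ h₁ h₂
      rw [bub_colSh_left]
      exact ih hW h₁ (h₂.shiftF (-a))
  | append _ _ ih₁ ih₂ =>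
      intro n₂ W hW j₁ j₂ p₁ p₂ f₁ f₂ h₁ h₂
      rw [bub_append_left]
      exact (ih₁ hW h₁ h₂).add (ih₂ hW h₁ h₂)
  | smul c _ ih =>
      intro n₂ W hW j₁ j₂ p₁ p₂ f₁ f₂ h₁ h₂
      rw [bub_smul_left]
      exact (ih hW h₁ h₂).smul c

/-- **COROLLARY (legs with budget `DG 3 2`)**: the bubble is `IsO (4 + min 3 (n₁ + n₂))` — degree 4 raw, 5 with one
vertex difference, 6 with two (the logarithmic order of the second moment), 7 with three. [folklore] -/
theorem isO_bub_dg3 {n₁ n₂ : ℕ} {V W : Stn I} (hV : Graded n₁ V) (hW : Graded n₂ W) {f₁ f₂ : Fam}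
    (h₁ : DG 3 2 f₁) (h₂ : DG 3 2 f₂) : IsO (4 + min 3 (n₁ + n₂)) (bub f₁ f₂ V W) :=
  (isO_bub hV hW h₁ h₂).mono (by omega)

/-- **THE LOG-FREE DEGREE**: total grading `≥ 3` ⇒ the bubble is `IsO 7`. [folklore] -/
theorem isO_seven {n₁ n₂ : ℕ} {V W : Stn I} (hV : Graded n₁ V) (hW : Graded n₂ W) (hn : 3 ≤ n₁ + n₂)
    {f₁ f₂ : Fam} (h₁ : DG 3 2 f₁) (h₂ : DG 3 2 f₂) : IsO 7 (bub f₁ f₂ V W) :=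
  (isO_bub hV hW h₁ h₂).mono (by omega)

/-- **THE LOG-FREE DEGREE THROUGH A SHARP TWO-POWER FAMILY** (both legs the same family `T.g`, e.g. Bałaban's
`k`-th effective propagator once (F1)–(F3) are supplied for it — BETA-SPEC §6.9 rows an5/an1, NOT provided here).
[folklore] -/
theorem isO_seven_twoPower (T : TwoPower) {B₃ : ℝ} (hB : 0 ≤ B₃) (hT : SharpDiff T B₃) {n₁ n₂ : ℕ}
    {V W : Stn I} (hV : Graded n₁ V) (hW : Graded n₂ W) (hn : 3 ≤ n₁ + n₂) : IsO 7 (bub T.g T.g V W) :=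
  isO_seven hV hW hn (dg_three T hB hT) (dg_three T hB hT)

/-- **THE FREE ANCHOR, UNCONDITIONALLY**: through the free legs `latticeGreen/2` a bubble of total grading `≥ 3` is
`IsO 7`. [folklore] -/
theorem isO_seven_free {n₁ n₂ : ℕ} {V W : Stn I} (hV : Graded n₁ V) (hW : Graded n₂ W) (hn : 3 ≤ n₁ + n₂) :
    IsO 7 (bub free.g free.g V W) :=
  isO_seven hV hW hn dg_three_free dg_three_free

end Stencil

/-! ## §6. Counting: an `IsO 7` kernel has absolutely bounded second-moment partial sums (no logarithm) -/

/-- **NO LOGARITHM FROM DEGREE 7**: if `F` is `IsO 7` then `Σ_{0<‖z‖∞≤M} |z_μ z_ν F(z)| ≤ A` with ONE constant for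
all `M`, `μ`, `ν` and `(L,k)` — by the shell count `#{‖z‖∞ = r+1} ≤ 80(r+1)³` of `Beta.TransferUV`
(`abs_sum_le_of_quintic`: shellwise `≤ A₇/(r+1)⁵` ⇒ `≤ 160A₇`).  Compare the degree-6 tables, whose second moments
grow like `log M` (`abs_sum_le_of_quartic`) and carry the one-loop coefficient. [folklore] -/
theorem sum_abs_moment_le {F : Fam} (hF : IsO 7 F) :
    ∃ A : ℝ, 0 ≤ A ∧ ∀ (L k M : ℕ) (μ ν : Fin 4),
      ∑ z ∈ annulus 4 0 M, |((z μ : ℤ) : ℝ) * ((z ν : ℤ) : ℝ) * F L k z| ≤ A := by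
  obtain ⟨A₇, hA, -, hdec⟩ := hF
  refine ⟨160 * A₇, by positivity, fun L k M μ ν => ?_⟩
  have h := TransferUV.abs_sum_le_of_quintic (M := M)
    (f := fun z => |((z μ : ℤ) : ℝ) * ((z ν : ℤ) : ℝ) * F L k z|) hA ?_
  · rwa [abs_of_nonneg (Finset.sum_nonneg fun z _ => abs_nonneg _)] at h
  · intro r z hz
    have hs : supNorm z = r + 1 := supNorm_eq_of_mem_sphere hz
    have hz0 : z ≠ 0 := ne_zero_of_mem_annulus hz
    have hzr : (supNorm z : ℝ) = (r : ℝ) + 1 := by rw [hs]; push_cast; ring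
    have hcoord : ∀ i : Fin 4, |((z i : ℤ) : ℝ)| ≤ (r : ℝ) + 1 := by
      intro i
      have h1 := LeadingCoefficient.abs_apply_le_norm (toReal z) i
      rw [toReal_apply, norm_toReal, hzr] at h1
      exact h1
    have hr1 : (0 : ℝ) < (r : ℝ) + 1 := by positivity
    rw [abs_abs, abs_mul, abs_mul]
    have hF' := hdec L k z hz0
    rw [hzr] at hF'
    calc |((z μ : ℤ) : ℝ)| * |((z ν : ℤ) : ℝ)| * |F L k z|
        ≤ ((r : ℝ) + 1) * ((r : ℝ) + 1) * (A₇ / ((r : ℝ) + 1) ^ 7) := by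
          apply mul_le_mul (mul_le_mul (hcoord μ) (hcoord ν) (abs_nonneg _) hr1.le) hF' (abs_nonneg _)
          positivity
      _ = A₇ / ((r : ℝ) + 1) ^ 5 := by field_simp

/-- **HEADLINE (the log-free mechanism, free anchor)**: a bubble of two graded located-pair stencils of total grading
`≥ 3` through the free legs has absolutely bounded second-moment partial sums, uniformly in the cutoff `M` — it
contributes NO logarithm, hence nothing to any one-loop (`log`-slope) coefficient read off the second moments.
[folklore] -/
theorem sum_abs_moment_bub_free_le {I : Type*} [Fintype I] {n₁ n₂ : ℕ} {V W : Stn I} (hV : Graded n₁ V)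
    (hW : Graded n₂ W) (hn : 3 ≤ n₁ + n₂) :
    ∃ A : ℝ, 0 ≤ A ∧ ∀ (L k M : ℕ) (μ ν : Fin 4),
      ∑ z ∈ annulus 4 0 M, |((z μ : ℤ) : ℝ) * ((z ν : ℤ) : ℝ) * bub free.g free.g V W L k z| ≤ A :=
  sum_abs_moment_le (isO_seven_free hV hW hn)

end Literature.MathematicalPhysics.QuantumFieldTheory.Balaban1983to89.Beta.GradedBubbles
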